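/-
Copyright (c) 2026 the pub-hodgecm-mathlib formalisation cell (harness21).  Prover seat hodgecm-mathlib-B-p14 (g32), 2026-09-01.  ROAD W bricks (W3)+(W4)
(generic): the elliptic Euler–Poincaré relation for a group acting on a tree with ONE vertex orbit and inversions (census `F0/P3a/F0P3a-p04/g13/MEMO-R2wild`).
-/
import Literature.Combinatorics.SimpleGraph.TreeAutomorphismLefschetzInfinite   -- ★-to-be (B-p14 g32, W4-graph) `natCard_fixed_add_natCard_fixedEdges_eq` (Lefschetz count with inversions, any vertex type)
import Mathlib.Algebra.Order.Group.End                                        -- `Group (G ≃g G)` (`RelIso`), `RelIso.mul_apply`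
import HarnessLib

/-!
# The elliptic Euler–Poincaré relation for a group acting on a tree with one orbit of vertices (inversions allowed)

Topic `Combinatorics/SimpleGraph`, namespace `Literature.Combinatorics.SimpleGraph.TreeAction`.  THEOREMS ONLY: no definition, no named fact, no instance,
no notation, no `sorry`; kernel lane.  Pure group ∕ graph theory (Mathlib `SimpleGraph`, `QuotientGroup`).

THE MATHEMATICS [Serre1980Trees, I.6.1 and II.1.2–1.3; Kottwitz1988, §2].  A group `Γ` acts on a tree `X` by graph automorphisms (`act : Γ →* (X ≃g X)`),
TRANSITIVELY ON VERTICES and TRANSITIVELY ON DARTS (ordered edges) — so with ONE orbit of geometric edges and with INVERSIONS (the model: `U(1,1)(E_w)` at a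
RAMIFIED place acting on the tree of `SL₂(F_v)`, or `PGL₂(F)`).  Let `v₀ ∼ v₁` be an edge, `K_v = Stab(v₀)`, `K_e = Stab{v₀, v₁}` (SET-WISE: it contains an
inversion), `I = K_v ∩ K_e = Stab(v₀, v₁)` (a flag of the barycentric subdivision `X′`).  Then `Γ⧸K_v = V(X)`, `Γ⧸K_e = E(X)` (geometric edges) and `Γ⧸I =`
darts `=` flags of `X′`, equivariantly (§1, orbit–stabiliser), and for every `γ ∈ Γ` with finitely many fixed vertices and fixed edges and a finite `⟨γ⟩`-orbit of
`v₀` (e.g. `γ` in a compact subgroup): **`#Fix_γ(Γ⧸K_v) + #Fix_γ(Γ⧸K_e) = #Fix_γ(Γ⧸I) + 1`** — the `γ`-fixed part of `X′` is a finite non-empty tree: with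
`e₊` = edges fixed pointwise, `e₋` = edges inverted, the three counts are `#FixV`, `e₊ + e₋`, `2e₊`, and the Lefschetz count of a finite invariant subtree
(★ `card_fixedVertices_add_card_invertedEdges`: `#FixV + e₋ = e₊ + 1`) is the claim (★ companion `TreeAutomorphismLefschetzInfinite`).  This is Kottwitz's hypothesis «`χ(X′^γ) = 1`» for the Euler–Poincaré
function `ν(K_v)⁻¹𝟙_{K_v} + ν(K_e)⁻¹𝟙_{K_e} − ν(I)⁻¹𝟙_I` of a group acting on a tree WITH inversions; consumer: the wildly (and tamely) ramified places of the rank-one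
unitary Euler–Poincaré letter (R2) (`Rogawski1990/RankOneEulerPoincareNonsplitRamifiedPackage`, level triple `(K♯_D, K, K♯_D ⊓ K)`).
HONEST LABEL: HC_CM is proved only modulo the cell's remaining named inputs (hLiu418, h413) until rung 0 closes; this file is unconditional and cites print only
for orientation.

## References
* [Serre1980Trees] J.-P. Serre, *Trees* (1980), Ch. I §6.1 (groups acting on trees, fixed points), Ch. II §1.2–1.3 (`GL₂`, inversions).
* [Kottwitz1988] R. E. Kottwitz, *Tamagawa numbers*, Ann. of Math. 127 (1988), 629–646, §2 (Euler–Poincaré functions).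
* [Meier2008] J. Meier, *Groups, Graphs and Trees* (2008), Thm. 3.46, Lemma 3.50.
-/

set_option autoImplicit false

open SimpleGraph MulAction

namespace Literature.Combinatorics.SimpleGraph.TreeAction

/-! ## §1 Orbit–stabiliser dictionaries for the fixed cosets -/

section Cosets

variable {Γ : Type*} [Group Γ] (K : Subgroup Γ) (γ : Γ)

/-- `γ` fixes the coset `gK` iff `g⁻¹ γ g ∈ K`. [cite: Serre1980Trees, I.6.1] -/
theorem smul_mk_eq_mk_iff (g : Γ) : γ • (QuotientGroup.mk g : Γ ⧸ K) = QuotientGroup.mk g ↔ g⁻¹ * γ * g ∈ K := by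
  rw [MulAction.Quotient.smul_mk, smul_eq_mul, eq_comm, QuotientGroup.eq, mul_assoc]

/-- **ORBIT–STABILISER FOR FIXED COSETS.**  If `f : Γ → X` is an orbit map of a transitive action — `f a = f b ↔ a⁻¹ b ∈ K` (so `K` is the stabiliser of
`f 1`) and `f` surjective — and `T : X → X` is «the action of `γ`» (`f (γ g) = T (f g)`), then the `γ`-fixed cosets of `Γ ⧸ K` are in bijection with the
`T`-fixed points of `X`. [cite: Serre1980Trees, I.6.1] -/
theorem nonempty_fixedBy_quotient_equiv {X : Type*} (f : Γ → X) (hf : ∀ a b : Γ, f a = f b ↔ a⁻¹ * b ∈ K) (hs : Function.Surjective f)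
    (T : X → X) (hT : ∀ g : Γ, f (γ * g) = T (f g)) :
    Nonempty (fixedBy (Γ ⧸ K) γ ≃ {x : X // T x = x}) := by
  classical
  -- `f` descends to a bijection `Γ ⧸ K ≃ X`
  let F : Γ ⧸ K → X := Quotient.lift f fun a b (hab : QuotientGroup.leftRel K a b) => (hf a b).2 (QuotientGroup.leftRel_apply.1 hab)
  have hF : ∀ g : Γ, F (QuotientGroup.mk g) = f g := fun _ => rfl
  have hFinj : Function.Injective F := by
    intro p q hpq
    induction p using QuotientGroup.induction_on with
    | H a =>
      induction q using QuotientGroup.induction_on with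
      | H b => exact QuotientGroup.eq.2 ((hf a b).1 hpq)
  have hFsurj : Function.Surjective F := fun x => by
    obtain ⟨g, rfl⟩ := hs x
    exact ⟨QuotientGroup.mk g, rfl⟩
  let Φ : Γ ⧸ K ≃ X := Equiv.ofBijective F ⟨hFinj, hFsurj⟩
  have hΦ : ∀ q : Γ ⧸ K, T (Φ q) = Φ (γ • q) := by
    intro q
    induction q using QuotientGroup.induction_on with
    | H g =>
      change T (F (QuotientGroup.mk g)) = F (γ • QuotientGroup.mk g)
      rw [MulAction.Quotient.smul_mk, smul_eq_mul, hF, hF, hT]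
  refine ⟨Φ.subtypeEquiv fun q => ?_⟩
  rw [MulAction.mem_fixedBy, hΦ]
  exact Φ.injective.eq_iff.symm

/-- Along an orbit map `f` (constant on `K`-cosets), a finite `⟨γ⟩`-orbit of the root coset gives a finite orbit `{f (γⁿ)}`. [cite: Serre1980Trees, I.6.1] -/
theorem finite_range_apply_pow_of_finite_range_mk {X : Type*} (f : Γ → X) (hf : ∀ a b : Γ, a⁻¹ * b ∈ K → f a = f b)
    (horb : (Set.range fun n : ℕ => ((γ ^ n : Γ) : Γ ⧸ K)).Finite) : (Set.range fun n : ℕ => f (γ ^ n)).Finite := by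
  let F : Γ ⧸ K → X := Quotient.lift f fun a b (hab : QuotientGroup.leftRel K a b) => hf a b (QuotientGroup.leftRel_apply.1 hab)
  have hF : ∀ g : Γ, F (QuotientGroup.mk g) = f g := fun _ => rfl
  refine (horb.image F).subset ?_
  rintro x ⟨n, rfl⟩
  exact ⟨(γ ^ n : Γ), ⟨n, rfl⟩, hF _⟩

end Cosets

/-! ## §2 The elliptic Euler–Poincaré relation for a vertex- and dart-transitive action on a tree -/

section Action

variable {V : Type*} {G : SimpleGraph V} {Γ : Type*} [Group Γ]

/-- **THE ELLIPTIC EULER–POINCARÉ RELATION FOR A GROUP ACTING ON A TREE WITH ONE ORBIT OF VERTICES (INVERSIONS ALLOWED).**  `Γ` acts on the tree `G` by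
automorphisms (`act`), transitively on vertices (`hV`) and on darts (`hD`); `v₀ ∼ v₁`; `Kv = Stab(v₀)`, `Ke = Stab{v₀, v₁}` (set-wise), `I = Stab(v₀, v₁)`.  For every
`γ ∈ Γ` with finitely many fixed cosets in `Γ ⧸ Kv` and `Γ ⧸ Ke` and a finite `⟨γ⟩`-orbit of the root coset:
`#Fix_γ(Γ ⧸ Kv) + #Fix_γ(Γ ⧸ Ke) = #Fix_γ(Γ ⧸ I) + 1` — orbit–stabiliser (§1) turns the three coset counts into fixed vertices, set-wise fixed edges and fixed darts
of `act γ`, and ★ `natCard_fixed_add_natCard_fixedEdges_eq` is the count. [cite: Serre1980Trees, I.6.1; II.1.2–1.3] [cite: Kottwitz1988, §2] -/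
theorem natCard_fixedBy_add_eq_natCard_fixedBy_add_one_of_treeAction (hT : G.IsTree) (act : Γ →* (G ≃g G))
    {v₀ v₁ : V} (h01 : G.Adj v₀ v₁) (hV : ∀ v : V, ∃ g : Γ, act g v₀ = v)
    (hD : ∀ a b : V, G.Adj a b → ∃ g : Γ, act g v₀ = a ∧ act g v₁ = b)
    (Kv Ke I : Subgroup Γ) (hKv : ∀ g : Γ, g ∈ Kv ↔ act g v₀ = v₀)
    (hKe : ∀ g : Γ, g ∈ Ke ↔ s(act g v₀, act g v₁) = s(v₀, v₁))
    (hI : ∀ g : Γ, g ∈ I ↔ act g v₀ = v₀ ∧ act g v₁ = v₁) (γ : Γ)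
    (hfinV : (fixedBy (Γ ⧸ Kv) γ).Finite) (hfinE : (fixedBy (Γ ⧸ Ke) γ).Finite)
    (horb : (Set.range fun n : ℕ => ((γ ^ n : Γ) : Γ ⧸ Kv)).Finite) :
    Nat.card (fixedBy (Γ ⧸ Kv) γ) + Nat.card (fixedBy (Γ ⧸ Ke) γ) = Nat.card (fixedBy (Γ ⧸ I) γ) + 1 := by
  classical
  -- bookkeeping for the action
  have hmul : ∀ (a b : Γ) (x : V), act (a * b) x = act a (act b x) := fun a b x => by rw [map_mul, RelIso.mul_apply]
  have key : ∀ (a b : Γ) (x y : V), act (a⁻¹ * b) x = y ↔ act b x = act a y := by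
    intro a b x y
    rw [hmul, map_inv]
    constructor
    · intro h; rw [← h, RelIso.apply_inv_self]
    · intro h; rw [h, RelIso.inv_apply_self]
  have hedge : ∀ (g : Γ) {x y : V}, G.Adj x y → s(act g x, act g y) ∈ G.edgeSet := fun g x y hxy =>
    (SimpleGraph.mem_edgeSet _).2 ((act g).map_adj_iff.2 hxy)
  have hmap : ∀ (a : Γ) (x y x' y' : V), s(act a x, act a y) = s(act a x', act a y') ↔ s(x, y) = s(x', y') := by
    intro a x y x' y'
    rw [← Sym2.map_mk (f := act a) x y, ← Sym2.map_mk (f := act a) x' y']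
    exact (Sym2.map.injective (act a).injective).eq_iff
  -- (A) vertices
  obtain ⟨eA⟩ := nonempty_fixedBy_quotient_equiv Kv γ (fun g => act g v₀)
    (fun a b => by rw [hKv, key]; exact eq_comm) hV (act γ) (fun g => hmul γ g v₀)
  -- (B) geometric edges
  obtain ⟨eB⟩ := nonempty_fixedBy_quotient_equiv Ke γ (fun g => (⟨s(act g v₀, act g v₁), hedge g h01⟩ : G.edgeSet))
    (fun a b => by
      rw [hKe, Subtype.ext_iff]
      show s(act a v₀, act a v₁) = s(act b v₀, act b v₁) ↔ s(act (a⁻¹ * b) v₀, act (a⁻¹ * b) v₁) = s(v₀, v₁)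
      rw [← hmap a (act (a⁻¹ * b) v₀) (act (a⁻¹ * b) v₁) v₀ v₁, ← hmul, ← hmul, mul_inv_cancel_left]
      exact eq_comm)
    (by
      rintro ⟨e, he⟩
      induction e using Sym2.ind with
      | h a b =>
        obtain ⟨g, hga, hgb⟩ := hD a b ((SimpleGraph.mem_edgeSet _).1 he)
        exact ⟨g, Subtype.ext (by simp only [hga, hgb])⟩)
    (fun e => (⟨Sym2.map (act γ) (e : Sym2 V), by
      obtain ⟨e, he⟩ := e
      induction e using Sym2.ind with
      | h a b => rw [Sym2.map_mk]; exact hedge γ ((SimpleGraph.mem_edgeSet _).1 he)⟩ : G.edgeSet))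
    (fun g => Subtype.ext (by
      show s(act (γ * g) v₀, act (γ * g) v₁) = Sym2.map (act γ) s(act g v₀, act g v₁)
      rw [Sym2.map_mk, hmul, hmul]))
  -- (I) darts
  obtain ⟨eC⟩ := nonempty_fixedBy_quotient_equiv I γ (fun g => (⟨(act g v₀, act g v₁), (act g).map_adj_iff.2 h01⟩ : G.Dart))
    (fun a b => by
      rw [hI, SimpleGraph.Dart.ext_iff]
      show (act a v₀, act a v₁) = (act b v₀, act b v₁) ↔ act (a⁻¹ * b) v₀ = v₀ ∧ act (a⁻¹ * b) v₁ = v₁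
      rw [key, key, Prod.mk.injEq]
      exact Iff.and eq_comm eq_comm)
    (by
      rintro ⟨⟨a, b⟩, hab⟩
      obtain ⟨g, hga, hgb⟩ := hD a b hab
      exact ⟨g, SimpleGraph.Dart.ext _ _ (by simp only [hga, hgb])⟩)
    (fun d => (⟨(act γ d.fst, act γ d.snd), (act γ).map_adj_iff.2 d.adj⟩ : G.Dart))
    (fun g => SimpleGraph.Dart.ext _ _ (by
      show (act (γ * g) v₀, act (γ * g) v₁) = (act γ (act g v₀), act γ (act g v₁))
      rw [hmul, hmul]))
  -- rewrite the three coset counts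
  have hBeq : Nat.card (fixedBy (Γ ⧸ Ke) γ) = Nat.card {e : G.edgeSet // Sym2.map (act γ) (e : Sym2 V) = e} := by
    rw [Nat.card_congr eB]
    exact Nat.card_congr (Equiv.subtypeEquivRight fun e => Subtype.ext_iff)
  have hCeq : Nat.card (fixedBy (Γ ⧸ I) γ) = Nat.card {d : G.Dart // act γ d.fst = d.fst ∧ act γ d.snd = d.snd} := by
    rw [Nat.card_congr eC]
    refine Nat.card_congr (Equiv.subtypeEquivRight fun d => ?_)
    rw [SimpleGraph.Dart.ext_iff]
    exact Prod.ext_iff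
  -- finiteness and the finite orbit
  haveI : Finite (fixedBy (Γ ⧸ Kv) γ) := hfinV.to_subtype
  haveI : Finite (fixedBy (Γ ⧸ Ke) γ) := hfinE.to_subtype
  have hA : {v : V | act γ v = v}.Finite := Set.finite_coe_iff.1 (Finite.of_equiv _ eA)
  have hB : {e : G.edgeSet | Sym2.map (act γ) (e : Sym2 V) = e}.Finite := by
    have : Finite {e : G.edgeSet // Sym2.map (act γ) (e : Sym2 V) = e} :=
      Finite.of_equiv _ (eB.trans (Equiv.subtypeEquivRight fun e => Subtype.ext_iff))
    exact Set.finite_coe_iff.1 this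
  have hSfin : (Set.range fun n : ℕ => act (γ ^ n) v₀).Finite :=
    finite_range_apply_pow_of_finite_range_mk Kv γ (fun g => act g v₀) (fun a b hab => by rw [eq_comm, ← key]; exact (hKv _).1 hab) horb
  have hSne : (Set.range fun n : ℕ => act (γ ^ n) v₀).Nonempty := ⟨act (γ ^ 0) v₀, 0, rfl⟩
  have hαS : ∀ s ∈ Set.range (fun n : ℕ => act (γ ^ n) v₀), act γ s ∈ Set.range (fun n : ℕ => act (γ ^ n) v₀) := by
    rintro s ⟨n, rfl⟩
    refine ⟨n + 1, ?_⟩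
    show act (γ ^ (n + 1)) v₀ = act γ (act (γ ^ n) v₀)
    rw [pow_succ', hmul]
  rw [Nat.card_congr eA, hBeq, hCeq]
  exact natCard_fixed_add_natCard_fixedEdges_eq hT (act γ) hA hB hSfin hSne hαS

/-- **The same, for an action given on vertices** (`act g : V → V` with `act 1 = id`, `act (g h) = act g ∘ act h`, preserving adjacency — the shape in which a
matrix group acts on a lattice tree, e.g. ★ `glVertexAct`): the graph automorphisms `Γ →* (G ≃g G)` are assembled here (each `act g` is invertible with
inverse `act g⁻¹`). [cite: Serre1980Trees, I.6.1; II.1.2–1.3] [cite: Kottwitz1988, §2] -/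
theorem natCard_fixedBy_add_eq_natCard_fixedBy_add_one_of_vertexAction (hT : G.IsTree) (act : Γ → V → V)
    (act_one : ∀ v : V, act 1 v = v) (act_mul : ∀ (g h : Γ) (v : V), act (g * h) v = act g (act h v))
    (act_adj : ∀ (g : Γ) (a b : V), G.Adj (act g a) (act g b) ↔ G.Adj a b)
    {v₀ v₁ : V} (h01 : G.Adj v₀ v₁) (hV : ∀ v : V, ∃ g : Γ, act g v₀ = v)
    (hD : ∀ a b : V, G.Adj a b → ∃ g : Γ, act g v₀ = a ∧ act g v₁ = b)
    (Kv Ke I : Subgroup Γ) (hKv : ∀ g : Γ, g ∈ Kv ↔ act g v₀ = v₀)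
    (hKe : ∀ g : Γ, g ∈ Ke ↔ s(act g v₀, act g v₁) = s(v₀, v₁))
    (hI : ∀ g : Γ, g ∈ I ↔ act g v₀ = v₀ ∧ act g v₁ = v₁) (γ : Γ)
    (hfinV : (fixedBy (Γ ⧸ Kv) γ).Finite) (hfinE : (fixedBy (Γ ⧸ Ke) γ).Finite)
    (horb : (Set.range fun n : ℕ => ((γ ^ n : Γ) : Γ ⧸ Kv)).Finite) :
    Nat.card (fixedBy (Γ ⧸ Kv) γ) + Nat.card (fixedBy (Γ ⧸ Ke) γ) = Nat.card (fixedBy (Γ ⧸ I) γ) + 1 := by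
  -- each `act g` is a graph automorphism with inverse `act g⁻¹`
  have hinv₁ : ∀ (g : Γ) (v : V), act g⁻¹ (act g v) = v := fun g v => by rw [← act_mul, inv_mul_cancel, act_one]
  have hinv₂ : ∀ (g : Γ) (v : V), act g (act g⁻¹ v) = v := fun g v => by rw [← act_mul, mul_inv_cancel, act_one]
  let ι : Γ → (G ≃g G) := fun g =>
    { toFun := act g
      invFun := act g⁻¹
      left_inv := hinv₁ g
      right_inv := hinv₂ g
      map_rel_iff' := by intro a b; exact act_adj g a b }
  have hι : ∀ (g : Γ) (v : V), ι g v = act g v := fun _ _ => rfl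
  let ρ : Γ →* (G ≃g G) :=
    { toFun := ι
      map_one' := by
        apply RelIso.ext; intro v
        rw [hι, act_one]; rfl
      map_mul' := by
        intro g h; apply RelIso.ext; intro v
        rw [RelIso.mul_apply, hι, hι, hι, act_mul] }
  have hρ : ∀ (g : Γ) (v : V), ρ g v = act g v := fun _ _ => rfl
  have h := natCard_fixedBy_add_eq_natCard_fixedBy_add_one_of_treeAction hT ρ h01 (fun v => by simpa only [hρ] using hV v)
    (fun a b hab => by simpa only [hρ] using hD a b hab) Kv Ke I (fun g => by rw [hKv, hρ]) (fun g => by rw [hKe, hρ, hρ])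
    (fun g => by rw [hI, hρ, hρ]) γ hfinV hfinE horb
  exact h

end Action


end Literature.Combinatorics.SimpleGraph.TreeAction
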